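import Summits.PneNP.PneNP.Theses.DescentTower
import Literature.Computability.Complexity.ChromaticNP
import Literature.Computability.Complexity.NPClosureProofs
import Literature.Computability.Complexity.ClayProblemProofs

/-!
# Route DescentTower — `Assembly` (stmt-PneNP-10686)

`Assembly := ThreeColKarpReducibleChromatic → ThreeColNotInP → PneNP` (bridge-free, rev 2): `CHROMATIC ∈ NP`
(`CHROMATIC_mem_NP`) and closure of `NP` under `≤ₚ` (`mem_NP_of_karpReducible_holds`) put `3-COL ∈ NP`; if Cook's
`PneNP` failed, the PROVED model bridges (`P_bool_eq_holds`, `NP_bool_eq_holds`, used inside the proof) would give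
`NP ⊆ P`, so `3-COL ∈ P`, contradicting `ThreeColNotInP`.
-/

set_option linter.dupNamespace false -- `Summit.PneNP.PneNP.…`: summit = sub-problem name (D-0017 single-conjunct layout)

namespace Summit.PneNP.PneNP.Theorems

open Literature.Computability.Complexity

/-- **Assembly item of route DescentTower (stmt-PneNP-10686)**: `ThreeColKarpReducibleChromatic → ThreeColNotInP → PneNP`
(`3-COL ∈ NP` by the Karp reduction to `CHROMATIC ∈ NP`; `¬PneNP` would put it in `P`). [cite: Karp1972, §4] [folklore] -/
theorem descentTower_assembly_proof : Summit.PneNP.PneNP.Theses.DescentTower.Assembly := by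
  unfold Summit.PneNP.PneNP.Theses.DescentTower.Assembly Summit.PneNP.PneNP.Theses.DescentTower.ThreeColKarpReducibleChromatic
    Summit.PneNP.PneNP.Theses.DescentTower.ThreeColNotInP
  intro hK hT
  have h3NP : encodingGraph.toLanguage {G : Σ n, SimpleGraph (Fin n) | G.2.Colorable 3} ∈ Nondeterministic.NP :=
    mem_NP_of_karpReducible_holds hK ChromaticNP.CHROMATIC_mem_NP
  by_contra hcon
  have hP : PNPWave0.P Bool = Classes.P := P_bool_eq_holds
  have hN : PNPWave0.NP Bool = Nondeterministic.NP := NP_bool_eq_holds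
  refine hT ?_
  by_contra h3P
  exact hcon ⟨_, hN ▸ h3NP, hP ▸ h3P⟩

end Summit.PneNP.PneNP.Theorems
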